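import Mathlib
import Summits.Ventures.HodgeRepro.Tier4.Common.AdelicDefs
import Summits.Ventures.HodgeRepro.Tier4.Common.SettingOfData
import Summits.Ventures.HodgeRepro.Tier4.Common.MixedPlane
import Summits.Ventures.HodgeRepro.Tier4.Common.MixedPlaneKType
import Summits.Ventures.HodgeRepro.Tier4.Common.RowPlane
import Summits.Ventures.HodgeRepro.Tier4.Common.RowTorus
import Summits.Ventures.HodgeRepro.Tier4.Line1.RTFSetting
import Summits.Ventures.HodgeRepro.Tier4.Line1.AdelicParts
import Summits.Ventures.HodgeRepro.Tier4.Line1.PlaneDefs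
import Summits.Ventures.HodgeRepro.Tier4.Line4.LevelCosetCongruence
import Summits.Ventures.HodgeRepro.Tier4.Line4.OrbitInvariant
import Summits.Ventures.HodgeRepro.Tier4.Line4.RationalLineScalars
import Summits.Ventures.HodgeRepro.Tier4.Line4.RowLineCoords
import Summits.Ventures.HodgeRepro.Tier4.Line4.OrbitFibre
import Summits.Ventures.HodgeRepro.Tier4.Line4.OrbitInvariantBridge
import Summits.Ventures.HodgeRepro.Tier4.Line4.OrbitInvariantFibre
import Summits.Ventures.HodgeRepro.Tier4.Line4.TraceShift

/-!
# Tier4/Line4/OrbitInvariantFibreTrace — the fibre of the orbit invariant WITHOUT the trace normalisation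
(C-L4-TRACE-WLOG, part 2 of 2: the transported row plane)

Blind re-derivation cell `pub-hodge-repro`, Tier 4 «prove the step» (README §9–§10), seat t4-L1-p3 (gen 4).
Tree path `lean/Summits/Ventures/HodgeRepro/Tier4/Line4/OrbitInvariantFibreTrace.lean`.

OrbitInvariantFibre's `orbitOf_eq_of_orbitInv_eq` / `orbitInv_ne_of_orbitOf_ne` (p705792) bind `ht : q.t = 0`, `hn`,
`hd : ¬ IsSquare (−q.n)`.  Here the same statements hold on the transported row plane for a GENERAL trace, with the
single binder `hd : ¬ IsSquare (q.t ^ 2 - 4 * q.n)` in their place (and `hb hε` dropped — binder list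
`hd ha ha' hb' hε' lam hlam hiso`): TraceShift's `orbitOf_eq_of_scalar_normForm_eq` with `Ω² = t Ω − n`
(`ofLinesRow_Ω_sq'`), the hermitian relation `Ω B = B (t·1 − Ωᵀ)` (`ofLinesRow_Ω_mul_B'`), the anisotropic rows
`e₀` and `e_j g'` (`form_e0_ne_zero'`, `form_row_g'_ne_zero'`, general trace), the block coordinates
(`row_coords_block`) and the `(0,0)`-norm `orbitInvK g m = x² + t x y + n y²` (OrbitInvariantBridge's
`orbitInvK_eq_normForm`).  `not_isSquare_discr_of_conj_ne` supplies `hd` from `DescribesCM` (`(2ω − t)² = t² − 4n`,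
fixed by the complex conjugation if `t² − 4n` were a square in `E⁺`).  No printed input.
HC_CM is NOT proved by anyone in this repository.
-/

namespace Summit.Ventures.HodgeRepro.Tier4.Line4

open Summit.Ventures.HodgeRepro.Tier4.Common Summit.Ventures.HodgeRepro.Tier4.Line1
  Summit.Ventures.HodgeRepro.Tier4.Line1.RTF NumberField Matrix
open scoped NumberField

noncomputable section

/-! ## 1. The row plane for a general trace -/

section Rows

variable {k : Type} [Field k] (q : QuadData k) (a b ε a' b' ε' : k)
  (g g' : Matrix (Fin 4) (Fin 4) k) (hgg' : g * g' = 1) (hg'g : g' * g = 1)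

/-- The Gram matrix of the row plane, explicitly (general trace). -/
theorem ofLinesRow_B_eq' :
    (PlaneData.ofLinesRow q a b ε).B =
      !![a * (2 * q.n), a * -q.t, 0, 0; a * -q.t, a * 2, 0, 0; 0, 0, ε * (b * (2 * q.n)), ε * (b * -q.t);
        0, 0, ε * (b * -q.t), ε * (b * 2)] := by
  show blockDiag4 (lineGramRow q a) (ε • lineGramRow q b) = _
  ext i j
  fin_cases i <;> fin_cases j <;> simp [blockDiag4, re4, lineGramRow, Matrix.coe_reindexAlgEquiv,
    Matrix.reindex_apply, Matrix.submatrix_apply, Matrix.fromBlocks] <;> rfl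

/-- The first row `e₀` is `B`-anisotropic (`a ≠ 0`, `n ≠ 0`). -/
theorem form_e0_ne_zero' [CharZero k] (hn : q.n ≠ 0) (ha : a ≠ 0) :
    (Pi.single 0 1 : Fin 4 → k) ᵥ* (PlaneData.ofLinesRow q a b ε).B ⬝ᵥ (Pi.single 0 1 : Fin 4 → k) ≠ 0 := by
  rw [ofLinesRow_B_eq' q a b ε]
  simp [Matrix.vecMul, dotProduct, Fin.sum_univ_four, ha, hn]

include hgg' hg'g in
/-- The rows `e₀ g'`, `e₂ g'` are `B`-anisotropic under the similitude (`a', b', ε', n ≠ 0`; general trace). -/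
theorem form_row_g'_ne_zero' [CharZero k] (hn : q.n ≠ 0) (ha' : a' ≠ 0) (hb' : b' ≠ 0) (hε' : ε' ≠ 0)
    (lam : k) (hlam : lam ≠ 0)
    (hiso : g * (PlaneData.ofLinesRow q a' b' ε').B * gᵀ = lam • (PlaneData.ofLinesRow q a b ε).B) (j : Fin 2) :
    ((![Pi.single 0 1, Pi.single 2 1] : Fin 2 → Fin 4 → k) j ᵥ* g') ᵥ* (PlaneData.ofLinesRow q a b ε).B ⬝ᵥ
      ((![Pi.single 0 1, Pi.single 2 1] : Fin 2 → Fin 4 → k) j ᵥ* g') ≠ 0 := by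
  have hB' := B'_eq_of_similitude q a b ε a' b' ε' g g' hgg' hg'g lam hiso
  have hiso' : g' * (PlaneData.ofLinesRow q a b ε).B * g'ᵀ = lam⁻¹ • (PlaneData.ofLinesRow q a' b' ε').B := by
    rw [hB', smul_smul, inv_mul_cancel₀ hlam, one_smul]
  have hform : ∀ u : Fin 4 → k, (u ᵥ* g') ᵥ* (PlaneData.ofLinesRow q a b ε).B ⬝ᵥ (u ᵥ* g') =
      lam⁻¹ * (u ᵥ* (PlaneData.ofLinesRow q a' b' ε').B ⬝ᵥ u) := by
    intro u
    have h1 : (u ᵥ* g') ᵥ* (PlaneData.ofLinesRow q a b ε).B ⬝ᵥ (u ᵥ* g') =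
        u ᵥ* (g' * (PlaneData.ofLinesRow q a b ε).B * g'ᵀ) ⬝ᵥ u := by
      rw [Matrix.vecMul_vecMul]
      conv_rhs => rw [← Matrix.vecMul_vecMul, ← Matrix.dotProduct_mulVec, Matrix.mulVec_transpose]
    rw [h1, hiso', Matrix.vecMul_smul, smul_dotProduct, smul_eq_mul]
  rw [hform]
  refine mul_ne_zero (inv_ne_zero hlam) ?_
  have hB := ofLinesRow_B_eq' q a' b' ε'
  fin_cases j <;> simp [hB, Matrix.vecMul, dotProduct, Fin.sum_univ_four, ha', hb', hε', hn]

end Rows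

/-! ## 2. The transported row plane, general trace -/

section Main

open MeasureTheory

variable {k : Type} [Field k] [NumberField k] (q : QuadData k) (a b ε a' b' ε' : k)
  (g g' : Matrix (Fin 4) (Fin 4) k) (hgg' : g * g' = 1) (hg'g : g' * g = 1)
  (hgΩ : g * (PlaneData.ofLinesRow q a b ε).Ω = (PlaneData.ofLinesRow q a b ε).Ω * g)

omit [NumberField k] in
/-- `Ω² = t Ω − n` on the row plane (general trace). -/
theorem ofLinesRow_Ω_sq' :
    (PlaneData.ofLinesRow q a b ε).Ω * (PlaneData.ofLinesRow q a b ε).Ω =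
      q.t • (PlaneData.ofLinesRow q a b ε).Ω - q.n • (1 : Matrix (Fin 4) (Fin 4) k) := by
  rw [ofLinesRow_Ω_eq_blockDiag4R, blockDiag4R_omegaMatR_eq]
  ext i j
  fin_cases i <;> fin_cases j <;> simp [Matrix.mul_apply, Fin.sum_univ_four] <;> ring

omit [NumberField k] in
/-- The hermitian relation `Ω B = B (t·1 − Ωᵀ)` on the row plane (general trace). -/
theorem ofLinesRow_Ω_mul_B' :
    (PlaneData.ofLinesRow q a b ε).Ω * (PlaneData.ofLinesRow q a b ε).B =
      (PlaneData.ofLinesRow q a b ε).B *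
        (q.t • (1 : Matrix (Fin 4) (Fin 4) k) - ((PlaneData.ofLinesRow q a b ε).Ω)ᵀ) := by
  rw [ofLinesRow_Ω_eq_blockDiag4R, blockDiag4R_omegaMatR_eq, ofLinesRow_B_eq' q a b ε]
  ext i j
  fin_cases i <;> fin_cases j <;>
    simp [Matrix.mul_apply, Fin.sum_univ_four, Matrix.one_apply, Matrix.transpose_apply] <;> ring

variable (W : PlaneData k) (hW : W = (PlaneData.ofLinesRow q a b ε).withTransportedTorus g g' hgg' hg'g hgΩ)
  [MeasurableSpace (GA W)] [BorelSpace (GA W)] (R : RTFData W) (μ : Measure (GA W))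
  [μ.IsHaarMeasure] [R.μT.IsHaarMeasure] [R.μT'.IsHaarMeasure] (DG : Set (GA W))
  (fdG : IsFundamentalDomain (rationalPoints W) DG μ) (compG : IsCompact (closure DG))
  (compT : IsCompact (closure R.DT)) (compT' : IsCompact (closure R.DT'))

include hW in
/-- **THE FIBRE OF THE ORBIT INVARIANT ON THE REGULAR LOCUS HAS ONE ELEMENT — GENERAL TRACE**: on the transported
row plane with `t² − 4n` not a square and the similitude `g B′ gᵀ = λ B`, two rational points `γ, γ'` whose four
block scalars are non-zero and with `orbitInv W g γ = orbitInv W g γ'` lie in the same orbit of the Setting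
`Setting.ofAdelicData W R μ DG fdG compG compT compT'` (OrbitInvariantFibre's `orbitOf_eq_of_orbitInv_eq` without
`t = 0`: the binders `ht hn hd` are replaced by `hd : ¬ IsSquare (q.t ^ 2 - 4 * q.n)`, and `hb hε` are not needed —
binder list `hd ha ha' hb' hε' lam hlam hiso`). -/
theorem orbitOf_eq_of_orbitInv_eq_trace (hd : ¬ IsSquare (q.t ^ 2 - 4 * q.n))
    (ha : a ≠ 0) (ha' : a' ≠ 0) (hb' : b' ≠ 0) (hε' : ε' ≠ 0) (lam : k) (hlam : lam ≠ 0)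
    (hiso : g * (PlaneData.ofLinesRow q a' b' ε').B * gᵀ = lam • (PlaneData.ofLinesRow q a b ε).B)
    {γ γ' : (Setting.ofAdelicData W R μ DG fdG compG compT compT').Gk}
    {m m' : Matrix (Fin 4) (Fin 4) k}
    (hm : GA.mat W (γ : GA W) = m.map (algebraMap k (Ad k)))
    (hm' : GA.mat W (γ' : GA W) = m'.map (algebraMap k (Ad k)))
    (hreg : ∀ i j : Fin 2, ¬ ((m * g) (![0, 2] i) (![0, 2] j) = 0 ∧ (m * g) (![1, 3] i) (![0, 2] j) = 0))
    (hreg' : ∀ i j : Fin 2, ¬ ((m' * g) (![0, 2] i) (![0, 2] j) = 0 ∧ (m' * g) (![1, 3] i) (![0, 2] j) = 0))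
    (hinv : orbitInv W g (γ : GA W) = orbitInv W g (γ' : GA W)) :
    (Setting.ofAdelicData W R μ DG fdG compG compT compT').orbitOf γ =
      (Setting.ofAdelicData W R μ DG fdG compG compT compT').orbitOf γ' := by
  subst hW
  have hn : q.n ≠ 0 := ne_zero_of_not_isSquare_discr hd
  -- the plane data
  have hΩ : ((PlaneData.ofLinesRow q a b ε).withTransportedTorus g g' hgg' hg'g hgΩ).Ω *
      ((PlaneData.ofLinesRow q a b ε).withTransportedTorus g g' hgg' hg'g hgΩ).Ω =
      q.t • ((PlaneData.ofLinesRow q a b ε).withTransportedTorus g g' hgg' hg'g hgΩ).Ω -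
        q.n • (1 : Matrix (Fin 4) (Fin 4) k) := ofLinesRow_Ω_sq' q a b ε
  have hΩB : ((PlaneData.ofLinesRow q a b ε).withTransportedTorus g g' hgg' hg'g hgΩ).Ω *
      ((PlaneData.ofLinesRow q a b ε).withTransportedTorus g g' hgg' hg'g hgΩ).B =
      ((PlaneData.ofLinesRow q a b ε).withTransportedTorus g g' hgg' hg'g hgΩ).B *
        (q.t • (1 : Matrix (Fin 4) (Fin 4) k) -
          (((PlaneData.ofLinesRow q a b ε).withTransportedTorus g g' hgg' hg'g hgΩ).Ω)ᵀ) :=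
    ofLinesRow_Ω_mul_B' q a b ε
  have hPB : ∀ i, ((PlaneData.ofLinesRow q a b ε).withTransportedTorus g g' hgg' hg'g hgΩ).P i *
      ((PlaneData.ofLinesRow q a b ε).withTransportedTorus g g' hgg' hg'g hgΩ).B =
      ((PlaneData.ofLinesRow q a b ε).withTransportedTorus g g' hgg' hg'g hgΩ).B *
        (((PlaneData.ofLinesRow q a b ε).withTransportedTorus g g' hgg' hg'g hgΩ).P i)ᵀ :=
    fun i => ofLinesRow_P_mul_B q a b ε i
  have hQB := transported_Q_selfAdjoint q a b ε a' b' ε' g g' hgg' hg'g hgΩ lam hlam hiso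
  -- the rows
  have hP0 : (PlaneData.ofLinesRow q a b ε).P 0 = blockDiag4R 1 0 := rfl
  have hP1 : (PlaneData.ofLinesRow q a b ε).P 1 = blockDiag4R 0 1 := rfl
  have hw : ∀ i, (![Pi.single 0 1, Pi.single 2 1] : Fin 2 → Fin 4 → k) i ᵥ*
      (PlaneData.ofLinesRow q a b ε).P i = (![Pi.single 0 1, Pi.single 2 1] : Fin 2 → Fin 4 → k) i := by
    intro i
    fin_cases i
    · show (Pi.single 0 1 : Fin 4 → k) ᵥ* (PlaneData.ofLinesRow q a b ε).P 0 = Pi.single 0 1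
      rw [hP0, blockDiag4R_one_zero_eq]
      ext l
      fin_cases l <;> simp [Matrix.vecMul, dotProduct, Fin.sum_univ_four]
    · show (Pi.single 2 1 : Fin 4 → k) ᵥ* (PlaneData.ofLinesRow q a b ε).P 1 = Pi.single 2 1
      rw [hP1, blockDiag4R_zero_one_eq]
      ext l
      fin_cases l <;> simp [Matrix.vecMul, dotProduct, Fin.sum_univ_four]
  have hw0 : ∀ i, (![Pi.single 0 1, Pi.single 2 1] : Fin 2 → Fin 4 → k) i ≠ 0 := by
    intro i
    fin_cases i
    · simp
    · simp
  have hv : ∀ j, ((![Pi.single 0 1, Pi.single 2 1] : Fin 2 → Fin 4 → k) j ᵥ* g') ᵥ*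
      ((PlaneData.ofLinesRow q a b ε).withTransportedTorus g g' hgg' hg'g hgΩ).Q j =
      (![Pi.single 0 1, Pi.single 2 1] : Fin 2 → Fin 4 → k) j ᵥ* g' := by
    intro j
    have hQ : ((PlaneData.ofLinesRow q a b ε).withTransportedTorus g g' hgg' hg'g hgΩ).Q j =
        g * (PlaneData.ofLinesRow q a b ε).P j * g' := rfl
    rw [hQ, Matrix.vecMul_vecMul, ← Matrix.mul_assoc, ← Matrix.mul_assoc, hg'g, Matrix.one_mul,
      ← Matrix.vecMul_vecMul]
    have := hw j
    rw [this]
  have ha0 : (![Pi.single 0 1, Pi.single 2 1] : Fin 2 → Fin 4 → k) 0 ᵥ*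
      ((PlaneData.ofLinesRow q a b ε).withTransportedTorus g g' hgg' hg'g hgΩ).B ⬝ᵥ
      (![Pi.single 0 1, Pi.single 2 1] : Fin 2 → Fin 4 → k) 0 ≠ 0 :=
    form_e0_ne_zero' q a b ε hn ha
  have hbj : ∀ j, ((![Pi.single 0 1, Pi.single 2 1] : Fin 2 → Fin 4 → k) j ᵥ* g') ᵥ*
      ((PlaneData.ofLinesRow q a b ε).withTransportedTorus g g' hgg' hg'g hgΩ).B ⬝ᵥ
      ((![Pi.single 0 1, Pi.single 2 1] : Fin 2 → Fin 4 → k) j ᵥ* g') ≠ 0 :=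
    fun j => form_row_g'_ne_zero' q a b ε a' b' ε' g g' hgg' hg'g hn ha' hb' hε' lam hlam hiso j
  -- the block scalars
  obtain ⟨hmΩ, -⟩ := rational_mat_props _ hm.symm
  obtain ⟨hmΩ', -⟩ := rational_mat_props _ hm'.symm
  have hxy := row_coords_block q a b ε g g' hgg' hg'g hgΩ hmΩ
  have hxy' := row_coords_block q a b ε g g' hgg' hg'g hgΩ hmΩ'
  -- the (0,0) norms agree
  have hK : orbitInvK g m = orbitInvK g m' := by
    apply algebraMap_Ad_injective
    rw [← orbitInv_eq_algebraMap _ g hm, ← orbitInv_eq_algebraMap _ g hm', hinv]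
  have h00 : (m' * g) (![0, 2] 0) (![0, 2] 0) ^ 2 +
        q.t * (m' * g) (![0, 2] 0) (![0, 2] 0) * (m' * g) (![1, 3] 0) (![0, 2] 0) +
        q.n * (m' * g) (![1, 3] 0) (![0, 2] 0) ^ 2 =
      (m * g) (![0, 2] 0) (![0, 2] 0) ^ 2 +
        q.t * (m * g) (![0, 2] 0) (![0, 2] 0) * (m * g) (![1, 3] 0) (![0, 2] 0) +
        q.n * (m * g) (![1, 3] 0) (![0, 2] 0) ^ 2 := by
    simp only [Matrix.cons_val_zero]
    rw [← orbitInvK_eq_normForm q a b ε g hgΩ hmΩ, ← orbitInvK_eq_normForm q a b ε g hgΩ hmΩ', hK]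
  exact orbitOf_eq_of_scalar_normForm_eq _ R μ DG fdG compG compT compT' hΩ hd hΩB hPB hQB hw hw0 hv ha0 hbj
    hm.symm hm'.symm hxy hxy' hreg hreg' h00

include hW in
/-- **OFF THE ORBIT, OFF THE FIBRE — GENERAL TRACE**: if the orbit of `γ` is not the orbit of `γ₀`, their
invariants differ (OrbitInvariantFibre's `orbitInv_ne_of_orbitOf_ne` without `t = 0`). -/
theorem orbitInv_ne_of_orbitOf_ne_trace (hd : ¬ IsSquare (q.t ^ 2 - 4 * q.n))
    (ha : a ≠ 0) (ha' : a' ≠ 0) (hb' : b' ≠ 0) (hε' : ε' ≠ 0) (lam : k) (hlam : lam ≠ 0)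
    (hiso : g * (PlaneData.ofLinesRow q a' b' ε').B * gᵀ = lam • (PlaneData.ofLinesRow q a b ε).B)
    {γ γ₀ : (Setting.ofAdelicData W R μ DG fdG compG compT compT').Gk}
    {m m₀ : Matrix (Fin 4) (Fin 4) k}
    (hm : GA.mat W (γ : GA W) = m.map (algebraMap k (Ad k)))
    (hm₀ : GA.mat W (γ₀ : GA W) = m₀.map (algebraMap k (Ad k)))
    (hreg : ∀ i j : Fin 2, ¬ ((m * g) (![0, 2] i) (![0, 2] j) = 0 ∧ (m * g) (![1, 3] i) (![0, 2] j) = 0))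
    (hreg₀ : ∀ i j : Fin 2, ¬ ((m₀ * g) (![0, 2] i) (![0, 2] j) = 0 ∧ (m₀ * g) (![1, 3] i) (![0, 2] j) = 0))
    (hne : (Setting.ofAdelicData W R μ DG fdG compG compT compT').orbitOf γ ≠
      (Setting.ofAdelicData W R μ DG fdG compG compT compT').orbitOf γ₀) :
    orbitInv W g (γ : GA W) ≠ orbitInv W g (γ₀ : GA W) :=
  fun h => hne (orbitOf_eq_of_orbitInv_eq_trace q a b ε a' b' ε' g g' hgg' hg'g hgΩ W hW R μ DG fdG compG compT
    compT' hd ha ha' hb' hε' lam hlam hiso hm hm₀ hreg hreg₀ h)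

end Main

/-! ## 3. The discriminant binder from the CM condition -/

section CM

variable {E : Type} [Field E] [NumberField E] [IsCMField E]

/-- **`t² − 4n` is not a square in `E⁺` when `X² − tX + n` has a root moved by the complex conjugation**: the `hd`
binder of `orbitOf_eq_of_orbitInv_eq_trace` from `DescribesCM` (NotSquareOfConjNe's `not_isSquare_neg_of_conj_ne`
without `t = 0`: `(2ω − t)² = t² − 4n`). -/
theorem not_isSquare_discr_of_conj_ne (q : QuadData (↥(maximalRealSubfield E))) (ω : E)
    (hω : ω ^ 2 = algebraMap (↥(maximalRealSubfield E)) E q.t * ω - algebraMap (↥(maximalRealSubfield E)) E q.n)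
    (hne : IsCMField.complexConj E ω ≠ ω) : ¬ IsSquare (q.t ^ 2 - 4 * q.n) := by
  rintro ⟨s, hs⟩
  have hcs : IsCMField.complexConj E (algebraMap (↥(maximalRealSubfield E)) E s) =
      algebraMap (↥(maximalRealSubfield E)) E s := IsCMField.complexConj_apply_eq_self E s
  have hct : IsCMField.complexConj E (algebraMap (↥(maximalRealSubfield E)) E q.t) =
      algebraMap (↥(maximalRealSubfield E)) E q.t := IsCMField.complexConj_apply_eq_self E q.t
  have h1 : (2 * ω - algebraMap (↥(maximalRealSubfield E)) E q.t) ^ 2 =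
      (algebraMap (↥(maximalRealSubfield E)) E s) ^ 2 := by
    have hs' : algebraMap (↥(maximalRealSubfield E)) E (q.t ^ 2 - 4 * q.n) =
        algebraMap (↥(maximalRealSubfield E)) E s * algebraMap (↥(maximalRealSubfield E)) E s := by
      rw [hs, map_mul]
    rw [map_sub, map_pow, map_mul, map_ofNat] at hs'
    linear_combination 4 * hω + hs'
  rcases sq_eq_sq_iff_eq_or_eq_neg.mp h1 with h | h
  · apply hne
    have hω' : ω = (algebraMap (↥(maximalRealSubfield E)) E s + algebraMap (↥(maximalRealSubfield E)) E q.t) / 2 := by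
      linear_combination h / 2
    rw [hω', map_div₀, map_add, map_ofNat, hcs, hct]
  · apply hne
    have hω' : ω = (-algebraMap (↥(maximalRealSubfield E)) E s + algebraMap (↥(maximalRealSubfield E)) E q.t) / 2 := by
      linear_combination h / 2
    rw [hω', map_div₀, map_add, map_neg, map_ofNat, hcs, hct]

end CM

end

end Summit.Ventures.HodgeRepro.Tier4.Line4
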